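import Summits.SmoothPoincare4.SmoothPoincare4.Theorems.SullivanDualWitnessChargeHelperMemberFarCovers
import Summits.SmoothPoincare4.SmoothPoincare4.Theorems.SullivanDualWitnessChargeHelperMemberGraphFunction
import Summits.SmoothPoincare4.SmoothPoincare4.Theorems.SullivanDualWitnessChargeSubstubFar
import Summits.SmoothPoincare4.SmoothPoincare4.Theorems.SullivanDualWitnessChargeFlatChart
import Mathlib.Analysis.Complex.Basic

/-!
# Helper `helper_familyProper` of line `Sketch` for crux `WitnessCharge`
(item stmt-SmoothPoincare4-7824; route `SullivanDual`, crux
`Summit.SmoothPoincare4.SmoothPoincare4.Theses.SullivanDual.WitnessCharge`; line `Sketch`,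
registered stub `helper_familyProper` of the lead's cycle-2 helper skeleton, wave 4 —
complete-family glue: properness)

**Points of the family inside a compact set have bounded parameters.** Let `J` be STANDARD on the
punctured `ε'`-chart-ball `B_{ε'}` at `p` (closed `ε'`-ball inside the chart target), and let
`F : ℂ → ℂ → Σ∖p` be a family such that every `F b` is a pencil member of intercept `b`
(`IsPencilMember J (F b) b`) and, for `‖b‖ > R₀`, `F b` is the far flat line
(`F b ξ ∈ B_{ε'}` and `Ycoord p (F b ξ) = (ξ, b)`). Then for every compact `K ⊆ Σ∖p` there are
`Bb, r` with `F b ξ ∈ K → ‖b‖ ≤ Bb ∧ ‖ξ‖ ≤ r`.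

Proof. The compact `K` misses a punctured chart-ball `B_η`, `η > 0`
(`exists_ball_disjoint_of_isCompact`). Put `Bb = max R₀ η⁻¹` and `R = max ε'⁻¹ η⁻¹ + 1`, `r = 2R`.
* If `‖b‖ > Bb` then `F b ξ ∈ B_{ε'}` with `Ycoord p (F b ξ) = (ξ, b)`, so
  `‖e (F b ξ) − e p‖⁻¹ = ‖realify (ξ, b)‖ ≥ ‖b‖ > η⁻¹` (`realify_Ycoord`, `norm_inversion`,
  `norm_le_norm_realify`), i.e. `F b ξ ∈ B_η`, hence `F b ξ ∉ K`.
* If `‖ξ‖ > 2R` then by the far covering `helper_memberFarCovers` (`R > ε'⁻¹`) `F b ξ ∈ B_{ε'}` with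
  `‖(Ycoord p (F b ξ)).1‖ > R > η⁻¹`, so `F b ξ ∈ B_η` (`inBall_of_inv_lt_norm_fst_Ycoord`), hence
  `F b ξ ∉ K`.
Contrapositively, `F b ξ ∈ K` forces `‖b‖ ≤ Bb` and `‖ξ‖ ≤ r`.
-/

noncomputable section

-- the registered namespace `Summit.SmoothPoincare4.SmoothPoincare4.…` repeats a component
set_option linter.dupNamespace false

open scoped Manifold ContDiff Topology
open Set Filter Literature.Geometry.Kaehler Literature.Geometry.Symplectic
  Literature.Topology.FourManifolds

namespace Summit.SmoothPoincare4.SmoothPoincare4.Theorems.WitnessCharge.PencilIncompleteness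

/-! ### A far flat point lies deep in the end -/

/-- A point of the punctured `ε'`-chart-ball whose flat coordinates are `(ξ, b)` with `η⁻¹ < ‖b‖`,
`η > 0`, lies in the punctured `η`-chart-ball: `‖e x − e p‖⁻¹ = ‖realify (ξ, b)‖ ≥ ‖b‖ > η⁻¹`. -/
theorem inBall_of_inv_lt_norm_of_Ycoord_eq {S : HomotopySphere 4} {p : S.carrier} {ε' : ℝ}
    {x : punctured p} (hx : InPuncturedChartBall p ε' x) {η : ℝ} (hη : 0 < η) {ξ b : ℂ}
    (hY : Ycoord p x = (ξ, b)) (hb : η⁻¹ < ‖b‖) : InPuncturedChartBall p η x := by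
  refine ⟨hx.1, ?_⟩
  rw [Metric.mem_ball, dist_eq_norm]
  have h1 : η⁻¹ < ‖realify (Ycoord p x)‖ := by
    rw [hY]
    exact hb.trans_le (norm_le_norm_realify ξ b)
  rw [realify_Ycoord, norm_inversion] at h1
  exact (inv_lt_inv₀ hη (norm_pos_iff.2 (sub_ne_zero_of_ball hx))).1 h1

/-! ### The helper -/

/-- **Properness of the complete family (registered stub `helper_familyProper`, complete-family
glue).** For `J` standard on the punctured `ε'`-chart-ball at `p` (closed `ε'`-ball inside the
chart target) and a family `F : ℂ → ℂ → Σ∖p` of pencil members `F b` of intercept `b` which for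
`‖b‖ > R₀` are the far flat lines (`F b ξ ∈ B_{ε'}`, `Ycoord p (F b ξ) = (ξ, b)`): the points of
the family inside a compact `K ⊆ Σ∖p` have bounded parameters,
`F b ξ ∈ K → ‖b‖ ≤ Bb ∧ ‖ξ‖ ≤ r`. Proof: `K` misses a punctured chart-ball `B_η`
(`exists_ball_disjoint_of_isCompact`); far intercepts `‖b‖ > max R₀ η⁻¹` put `F b ξ` in `B_η`
(flat coordinates `(ξ, b)`), and far parameters `‖ξ‖ > 2R`, `R = max ε'⁻¹ η⁻¹ + 1`, put `F b ξ`
in `B_η` by the far covering `helper_memberFarCovers` and `inBall_of_inv_lt_norm_fst_Ycoord`. -/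
theorem helper_familyProper :
    ∀ (S : HomotopySphere 4) (p : S.carrier)
      (J : ∀ x : punctured p, TangentSpace (𝓡 4) x →L[ℝ] TangentSpace (𝓡 4) x) (ε' : ℝ),
      0 < ε' →
      Metric.closedBall (extChartAt (𝓡 4) p p) ε' ⊆ (extChartAt (𝓡 4) p).target →
      (∀ x : punctured p, InPuncturedChartBall p ε' x →
        ∀ (v : TangentSpace (𝓡 4) x) (b : EuclideanSpace ℝ (Fin 4)),
          inner ℝ (fderiv ℝ inversion (extChartAt (𝓡 4) p x.1 - extChartAt (𝓡 4) p p)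
            (mfderiv (𝓡 4) 𝓘(ℝ, EuclideanSpace ℝ (Fin 4))
              (fun z : punctured p => extChartAt (𝓡 4) p z.1) x (J x v))) b
          = stdSymplecticForm (fderiv ℝ inversion (extChartAt (𝓡 4) p x.1 - extChartAt (𝓡 4) p p)
            (mfderiv (𝓡 4) 𝓘(ℝ, EuclideanSpace ℝ (Fin 4))
              (fun z : punctured p => extChartAt (𝓡 4) p z.1) x v)) b) →
      ∀ (F : ℂ → ℂ → punctured p) (R₀ : ℝ), (∀ b : ℂ, IsPencilMember J (F b) b) →
        (∀ b ξ : ℂ, R₀ < ‖b‖ →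
          InPuncturedChartBall p ε' (F b ξ) ∧ Ycoord p (F b ξ) = (ξ, b)) →
        ∀ K : Set (punctured p), IsCompact K →
          ∃ Bb r : ℝ, ∀ b ξ : ℂ, F b ξ ∈ K → ‖b‖ ≤ Bb ∧ ‖ξ‖ ≤ r := by
  intro S p J ε' hε' hball hJstd F R₀ hmem hfar K hK
  -- the compact `K` misses a punctured chart-ball `B_η`
  obtain ⟨η, hη, hηK⟩ := exists_ball_disjoint_of_isCompact hK
  -- the radius of the far covering: `R > ε'⁻¹` and `R > η⁻¹`
  have hR₁ : ε'⁻¹ < max ε'⁻¹ η⁻¹ + 1 := (le_max_left _ _).trans_lt (lt_add_one _)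
  have hR₂ : η⁻¹ < max ε'⁻¹ η⁻¹ + 1 := (le_max_right _ _).trans_lt (lt_add_one _)
  refine ⟨max R₀ η⁻¹, 2 * (max ε'⁻¹ η⁻¹ + 1), fun b ξ hξK => ⟨?_, ?_⟩⟩
  · -- far intercepts: `F b` is the far flat line, and `F b ξ ∈ B_η` misses `K`
    refine le_of_not_gt fun hb => ?_
    obtain ⟨hin, hY⟩ := hfar b ξ ((le_max_left _ _).trans_lt hb)
    exact hηK (F b ξ)
      (inBall_of_inv_lt_norm_of_Ycoord_eq hin hη hY ((le_max_right _ _).trans_lt hb)) hξK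
  · -- far parameters: the far covering puts `F b ξ` in `B_{ε'}` with `‖(Ycoord p (F b ξ)).1‖ > R`
    refine le_of_not_gt fun hξ => ?_
    obtain ⟨hin, hR⟩ :=
      helper_memberFarCovers S p J ε' (F b) b hε' hball hJstd (hmem b) _ hR₁ ξ hξ
    exact hηK (F b ξ) (inBall_of_inv_lt_norm_fst_Ycoord hin hη (hR₂.trans hR)) hξK

end Summit.SmoothPoincare4.SmoothPoincare4.Theorems.WitnessCharge.PencilIncompleteness
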